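import Summits.QuantumAdvantage.QuantumAdvantage.Theorems.RingSolutionsNotLowDegVerifiable
import Literature.Computability.MetaComplexity.SmolenskyCorrelationRestrict
import Literature.Computability.MetaComplexity.RazborovSmolenskyApprox
import Literature.Computability.MetaComplexity.SmolenskyParity
import HarnessLib

/-!
# Parity-product foreign rings, part 1/3: the NAND ring on the tree's `δ₀` pattern (support for item stmt-QuantumAdvantage-30910)

Cell decomp-qadv, seat lens-5 («finite range + asymptotic regime + bridge»), generation 8 — land port of §10 of the node
«TameDial» (sha256 fd9002fb…, published under the cell's HOME/decomp-qadv-lens-5/g8/TameDial.lean).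

`exists_nand_ring`: for blocks `T₁ … T_r ⊆ Fin (8t)` with `∏ |T_j| ≤ 4t` there is a single-ring strategy `Q` of
`𝔽₃`-degree `≤ r` on the ring of length `8t` whose WIN EVENT against the foreign pattern `δ₀ = Theorems.delta0 t`
is exactly `NAND(ℓ₁,…,ℓ_r)`, `ℓ_j(y) = ⊕_{a ∈ T_j} y_a` (put the monomial `∏_j y_{τ_j}` of each tuple
`τ ∈ ∏ T_j` at its own odd position; `Theorems.rel_delta0_iff` + `|A₁ × ⋯ × A_r| ≡ ∏ |A_j| (mod 2)`).
This is the explicit ROUGH foreign ring behind `spreadDial_noAlgebraicShadow3` (part 3/3): the residual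
`SpreadDial.PureCover3` (stmt-30910) cannot be closed through an algebraic shadow of dense foreign win events.
-/

set_option linter.style.longLine false
set_option linter.dupNamespace false

open Finset
open Literature.Computability.QuantumComplexity Literature.Computability.MetaComplexity
open Literature.Computability.QuantumComplexity.RingHLF

namespace Summit.QuantumAdvantage.QuantumAdvantage.Theorems.TameDial

/-- arithmetic: a product of naturals is odd iff every factor is. -/
theorem prod_mod_two_eq_one_iff {ι : Type*} (s : Finset ι) (f : ι → ℕ) :
    (∏ j ∈ s, f j) % 2 = 1 ↔ ∀ j ∈ s, f j % 2 = 1 := by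
  classical
  refine Finset.induction_on s (by simp) (fun a s ha ih => ?_)
  rw [Finset.prod_insert ha, Finset.forall_mem_insert, ← ih, ← Nat.odd_iff, Nat.odd_mul, Nat.odd_iff, Nat.odd_iff]

/-- **THE PARITY-PRODUCT RING `R_T` IS REAL** (certified, ring lengths `n = 8t`): on the tree's pattern `δ₀`
(`Theorems.rel_delta0_iff`: `Rel δ₀ z ⟺` the bits at ODD positions have even parity) put the MONOMIAL
`∏_j y_{τ j}` of the tuple `τ ∈ ∏_j T j` at the odd position `2·idx(τ) + 1` and `0` elsewhere: the ring wins iff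
`#{τ | ∀ j, y (τ j)} = ∏_j #{a ∈ T j | y a}` is even, i.e. iff NOT all the block parities `⊕_{a ∈ T j} y_a` are odd.
Answers have degree `≤ r`; capacity `∏ |T j| ≤ 4t`. [kernel] -/
theorem exists_nand_ring {t : ℕ} (ht : 1 ≤ t) {r : ℕ} (T : Fin r → Finset (Fin (8 * t)))
    (hM : (∏ j, (T j).card) ≤ 4 * t) :
    ∃ Q : Fin (8 * t) → Smolensky.CubeFn (ZMod 3) (8 * t),
      (∀ i, Q i ∈ Smolensky.lowDeg (ZMod 3) (8 * t) r) ∧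
      ∀ y, RingHLF.Rel (Theorems.delta0 t) (fun i => decide (Q i y = 1)) ↔
        ¬ ∀ j, ((T j).filter fun a => y a = true).card % 2 = 1 := by
  classical
  set M := Fintype.card ((j : Fin r) → ↥(T j)) with hMdef
  have hMcard : M = ∏ j, (T j).card := by rw [hMdef, Fintype.card_pi]; simp
  have hM4 : M ≤ 4 * t := hMcard ▸ hM
  let e : ((j : Fin r) → ↥(T j)) ≃ Fin M := Fintype.equivFin _
  let S : ((j : Fin r) → ↥(T j)) → Finset (Fin (8 * t)) := fun τ => univ.image fun j => (τ j : Fin (8 * t))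
  have hScard : ∀ τ, (S τ).card ≤ r := fun τ => card_image_le.trans (by simp)
  have hSall : ∀ τ (y : Fin (8 * t) → Bool), (∀ i ∈ S τ, y i = true) ↔ ∀ j, y (τ j) = true := by
    intro τ y
    simp only [S, mem_image, mem_univ, true_and, forall_exists_index, forall_apply_eq_imp_iff]
  let Q : Fin (8 * t) → Smolensky.CubeFn (ZMod 3) (8 * t) := fun i =>
    if h : i.val % 2 = 1 ∧ i.val / 2 < M then Smolensky.mono (ZMod 3) (S (e.symm ⟨i.val / 2, h.2⟩)) else 0
  refine ⟨Q, fun i => ?_, fun y => ?_⟩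
  · by_cases h : i.val % 2 = 1 ∧ i.val / 2 < M
    · simp only [Q, dif_pos h]; exact Smolensky.mono_mem_lowDeg (hScard _)
    · simp only [Q, dif_neg h]; exact Submodule.zero_mem _
  · rw [Theorems.rel_delta0_iff ht, Theorems.dot2_oddInd_eq]
    have hbit : ∀ i : Fin (8 * t), decide (Q i y = 1) = true ↔
        ∃ h : i.val % 2 = 1 ∧ i.val / 2 < M, ∀ j, y ((e.symm ⟨i.val / 2, h.2⟩) j) = true := by
      intro i
      rw [decide_eq_true_iff]
      by_cases h : i.val % 2 = 1 ∧ i.val / 2 < M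
      · simp only [Q, dif_pos h, Smolensky.mono_apply, hSall]
        constructor
        · intro h1
          refine ⟨h, ?_⟩
          by_contra hne
          rw [if_neg hne] at h1
          exact zero_ne_one h1
        · rintro ⟨_, hall⟩
          rw [if_pos hall]
      · simp only [Q, dif_neg h, Pi.zero_apply, zero_ne_one, false_iff]
        rintro ⟨h', _⟩
        exact h h'
    have hcount : ((univ.filter fun i : Fin (8 * t) => i.val % 2 = 1).filter
        fun i => decide (Q i y = 1) = true).card = ∏ j, ((T j).filter fun a => y a = true).card := by
      have himg : ((univ.filter fun i : Fin (8 * t) => i.val % 2 = 1).filter fun i => decide (Q i y = 1) = true) =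
          (univ.filter fun idx : Fin M => ∀ j, y ((e.symm idx) j) = true).image
            fun idx => (⟨2 * idx.val + 1, by omega⟩ : Fin (8 * t)) := by
        ext i
        simp only [mem_filter, mem_univ, true_and, mem_image]
        constructor
        · rintro ⟨_, hQ⟩
          obtain ⟨h, hall⟩ := (hbit i).mp hQ
          refine ⟨⟨i.val / 2, h.2⟩, hall, Fin.ext ?_⟩
          dsimp only
          omega
        · rintro ⟨idx, hall, rfl⟩
          have h : (2 * idx.val + 1) % 2 = 1 ∧ (2 * idx.val + 1) / 2 < M := ⟨by omega, by omega⟩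
          refine ⟨h.1, (hbit _).mpr ⟨h, ?_⟩⟩
          have hidx : (⟨(2 * idx.val + 1) / 2, h.2⟩ : Fin M) = idx := Fin.ext (by dsimp only; omega)
          rw [hidx]
          exact hall
      rw [himg, card_image_of_injective _ (fun a b hab => Fin.ext (by
        have := congrArg Fin.val hab; dsimp only at this; omega))]
      have h1 : (univ.filter fun idx : Fin M => ∀ j, y ((e.symm idx) j) = true).card =
          (univ.filter fun τ : (j : Fin r) → ↥(T j) => ∀ j, y (τ j) = true).card := by
        refine card_bij (fun idx _ => e.symm idx) (fun idx hidx => ?_) (fun a _ b _ h => e.symm.injective h)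
          (fun τ hτ => ⟨e τ, ?_, e.symm_apply_apply τ⟩)
        · simp only [mem_filter, mem_univ, true_and] at hidx ⊢
          exact hidx
        · simp only [mem_filter, mem_univ, true_and, Equiv.symm_apply_apply] at hτ ⊢
          exact hτ
      rw [h1]
      have h2 : (univ.filter fun τ : (j : Fin r) → ↥(T j) => ∀ j, y (τ j) = true).card =
          Fintype.card {τ : (j : Fin r) → ↥(T j) // ∀ j, y (τ j) = true} := (Fintype.card_subtype _).symm
      rw [h2, Fintype.card_congr (Equiv.subtypePiEquivPi (p := fun j (b : ↥(T j)) => y b = true)),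
        Fintype.card_pi]
      refine Finset.prod_congr rfl fun j _ => ?_
      rw [Fintype.card_congr (Equiv.subtypeSubtypeEquivSubtypeInter (fun a : Fin (8 * t) => a ∈ T j)
        (fun a => y a = true)), Fintype.card_subtype]
      congr 1
      ext a
      simp [mem_filter]
    rw [hcount]
    have hpar := prod_mod_two_eq_one_iff (univ : Finset (Fin r)) (fun j => ((T j).filter fun a => y a = true).card)
    have h01 := Nat.mod_two_eq_zero_or_one (∏ j, ((T j).filter fun a => y a = true).card)
    constructor
    · intro h0 hall
      have h1 := hpar.mpr fun j _ => hall j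
      omega
    · intro hn
      rcases h01 with h0 | h1
      · exact h0
      · exact absurd (fun j => hpar.mp h1 j (mem_univ j)) hn

end Summit.QuantumAdvantage.QuantumAdvantage.Theorems.TameDial
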